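import Literature.NumberTheory.Sieve.MaynardSieveLevel
import Literature.NumberTheory.Sieve.PolymathSieveAsymptotics
import HarnessLib

/-!
# Polymath 8b, §4.2: the level-of-distribution input of Theorem 3.5(i) — `θ` in arithmetic progressions

Trunk: AntSieve / parity.S13.  Part of the proof of the named fact
`Literature.NumberTheory.Sieve.theta_divisorSumWeights_asymptotic` (**Theorem 3.5(i)** of D. H. J. Polymath,
*Variants of the Selberg sieve, and bounded intervals containing many primes*, Res. Math. Sci. 1:12
(2014) = arXiv:1407.4897, proved in §4.2 "The Elliott–Halberstam case", pp. 13–14), itself a leaf of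
the decomposition of `Literature.NumberTheory.Sieve.frequently_nth_prime_succ_le_add_polymath`
(`H₁ ≤ 246`).  In §4.2 the level-of-distribution hypothesis `EH[ϑ]` (rendered in the tree by
`PrimesHaveLevel ϑ`, equivalently — `primesHaveLevel_iff_primesHaveLevelPi_holds` — by the `π`-form
`PrimesHaveLevelPi ϑ`) is consumed once, to bound
`∑_{d,d'} (∏ |F_i||G_i|) |Δ(1_{[x+h_k,2x+h_k]} θ; a (q))|` (display (sosmall), p. 13) after "each choice
`q` … is associated to `O(τ(q)^{O(1)})` choices", the crude bound, (divisor-2) and Cauchy–Schwarz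
(p. 14).  This file PROVES the two analytic inputs of that step:

* `primeCountingAPErrMax x q = E_π(x; q) = max_{1 ≤ y ≤ x} max_{(a,q)=1} |π(y;q,a) − π(y)/φ(q)|` (the
  summand of `PrimesHaveLevelPi`, `primesHaveLevelPi_iff_errMax`), its trivial bound `≤ 4x/φ(q)`
  (`primeCountingAPErrMax_le`), and **the divisor-weighted level estimate**
  `PrimesHaveLevelPi.isBigO_sum_pow_omega_mul_errMax`:
  `∑_{q ≤ x^{ϑ−ε}} K^{ω(q)} E_π(x; q) ≪_{A,K,ε} x/(log x)^A` (Cauchy–Schwarz, the trivial bound,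
  `∑_{q ≤ x} K^{2ω(q)}/φ(q) ≪ (log x)^{2K²}` from `MaynardSieveLevel.lean`, and the hypothesis at
  `2A + 2K²`; the `max_y` version of `MaynardPrimesHaveLevel.isBigO_sum_pow_omega_mul`).
* `thetaAP q r X₁ X₂ = ∑_{X₁<m≤X₂, m≡r (q)} θ(m)`, `thetaInterval X₁ X₂ = ∑_{X₁<m≤X₂} θ(m)` (`θ(n) = log n`
  at primes, `GPY.theta`; the interval form of the tree's discrepancy `chebyshevThetaDisc`,
  `LevelOfDistributionProofs.lean`, via the bridge `thetaAP_sub_eq_chebyshevThetaDisc`) and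
  **`abs_thetaAP_sub_le`**: for `(r, q) = 1` and `X₁ ≤ X₂`,
  `|thetaAP q r X₁ X₂ − thetaInterval X₁ X₂/φ(q)| ≤ 4 log X₂ · E_π(X₂; q)`, by the tree's `π → ϑ` partial
  summation `abs_chebyshevThetaDisc_le_of_primeCountingDisc`.  Comparing with `π` rather than with `ψ`
  sidesteps the prime powers (the paper's "`|Δ(… θ …) − Δ(… Λ …)| ≲ √(x/q)`", p. 14).

## References

* D. H. J. Polymath, *Variants of the Selberg sieve, and bounded intervals containing many primes*,
  Res. Math. Sci. 1 (2014), Art. 12; arXiv:1407.4897, §4.2, pp. 13–14. [Polymath8b2014]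
* H. Iwaniec, E. Kowalski, *Analytic Number Theory*, AMS Colloquium Publ. 53 (2004), Thm 17.1 and the
  remark following it (the `π`-form of the level of distribution). [IwaniecKowalski2004]
-/

noncomputable section

open Finset Filter Asymptotics
open scoped BigOperators ArithmeticFunction.omega

namespace Literature.NumberTheory.Sieve

/-! ### The maximal `π`-error `E_π(x; q) = max_{1 ≤ y ≤ x} max_{(a,q)=1} |π(y; q, a) − π(y)/φ(q)|` -/

/-- `E_π(x; q) := max_{1 ≤ y ≤ x} max_{(a,q)=1} |π(y; q, a) − π(y)/φ(q)|`, the summand of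
`PrimesHaveLevelPi` (the `π`-form of the level of distribution of the primes, Iwaniec–Kowalski Thm 17.1
and the remark following it), written with `primeCountingAPErr`. Junk value `0` for `x < 1`
(empty index type). [cite: IwaniecKowalski2004, Theorem 17.1] -/
def primeCountingAPErrMax (x : ℝ) (q : ℕ) : ℝ :=
  ⨆ y : Set.Icc (1 : ℝ) x, primeCountingAPErr y q

/-- `PrimesHaveLevelPi θ` in terms of `primeCountingAPErrMax` (definitional unfolding). [folklore] -/
theorem primesHaveLevelPi_iff_errMax {θ : ℝ} :
    PrimesHaveLevelPi θ ↔ ∀ A : ℝ, 0 < A → ∀ ε : ℝ, 0 < ε →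
      (fun x : ℝ => ∑ q ∈ Icc 1 ⌊x ^ (θ - ε)⌋₊, primeCountingAPErrMax x q) =O[atTop]
        fun x : ℝ => x / Real.log x ^ A :=
  Iff.rfl

/-- `E_π(x; q) ≥ 0`. [folklore] -/
theorem primeCountingAPErrMax_nonneg (x : ℝ) (q : ℕ) : 0 ≤ primeCountingAPErrMax x q :=
  Real.iSup_nonneg fun _ => primeCountingAPErr_nonneg _ _

/-- A trivial bound valid for all `q ≥ 1`, `y ≥ 0` (no `q ≤ y` needed, unlike
`MaynardSieveLevel.primeCountingAPErr_le`, whose proof this repeats): `max_a |π(y;q,a) − π(y)/φ(q)| ≤ y/φ(q) + 2`.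
[folklore] -/
theorem primeCountingAPErr_le' {y : ℝ} (hy : 0 ≤ y) {q : ℕ} (hq : 1 ≤ q) :
    primeCountingAPErr y q ≤ y / Nat.totient q + 2 := by
  haveI : NeZero q := ⟨by omega⟩
  have hφpos : (0 : ℝ) < Nat.totient q := by exact_mod_cast Nat.totient_pos.2 hq
  have hφq : (Nat.totient q : ℝ) ≤ q := by exact_mod_cast Nat.totient_le q
  have hfl : ((⌊y⌋₊ : ℕ) : ℝ) ≤ y := Nat.floor_le hy
  refine Real.iSup_le (fun a => ?_) (by positivity)
  rw [abs_le]
  have hπ : (Nat.primeCounting ⌊y⌋₊ : ℝ) ≤ y := by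
    have : Nat.primeCounting ⌊y⌋₊ ≤ ⌊y⌋₊ := by
      rw [← Nat.primesLE_card_eq_primeCounting, Nat.primesLE_eq_filter_Icc_one]
      exact (Finset.card_filter_le _ _).trans (by simp)
    exact le_trans (by exact_mod_cast this) hfl
  have hπq : (LevelOfDistribution.primeCountingMod q (a : ZMod q).val ⌊y⌋₊ : ℝ) ≤ y / Nat.totient q + 2 := by
    have h1 := primeCountingMod_le q (a : ZMod q).val ⌊y⌋₊ (by omega)
    have h2 : ((⌊y⌋₊ / q : ℕ) : ℝ) ≤ y / q := by
      calc ((⌊y⌋₊ / q : ℕ) : ℝ) ≤ ((⌊y⌋₊ : ℕ) : ℝ) / q := Nat.cast_div_le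
        _ ≤ y / q := by gcongr
    have h3 : y / q ≤ y / Nat.totient q := div_le_div_of_nonneg_left hy hφpos hφq
    calc (LevelOfDistribution.primeCountingMod q (a : ZMod q).val ⌊y⌋₊ : ℝ) ≤ ((⌊y⌋₊ / q + 2 : ℕ) : ℝ) := by
          exact_mod_cast h1
      _ = ((⌊y⌋₊ / q : ℕ) : ℝ) + 2 := by push_cast; ring
      _ ≤ y / Nat.totient q + 2 := by linarith
  have hdiv : (Nat.primeCounting ⌊y⌋₊ : ℝ) / Nat.totient q ≤ y / Nat.totient q := by gcongr
  have h0a : 0 ≤ (LevelOfDistribution.primeCountingMod q (a : ZMod q).val ⌊y⌋₊ : ℝ) := Nat.cast_nonneg _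
  have h0b : 0 ≤ (Nat.primeCounting ⌊y⌋₊ : ℝ) / Nat.totient q := by positivity
  constructor <;> linarith

/-- The range of `y ↦ max_a |π(y;q,a) − π(y)/φ(q)|`, `1 ≤ y ≤ x`, is bounded above (`q ≥ 1`). [folklore] -/
theorem bddAbove_range_primeCountingAPErr (x : ℝ) {q : ℕ} (hq : 1 ≤ q) :
    BddAbove (Set.range fun y : Set.Icc (1 : ℝ) x => primeCountingAPErr y q) := by
  refine ⟨|x| / Nat.totient q + 2, ?_⟩
  rintro _ ⟨y, rfl⟩
  have hy0 : (0 : ℝ) ≤ y := le_trans zero_le_one y.2.1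
  refine (primeCountingAPErr_le' hy0 hq).trans ?_
  gcongr
  exact le_trans y.2.2 (le_abs_self x)

/-- Each `|π(⌊y⌋; q, a) − π(⌊y⌋)/φ(q)|`, `1 ≤ y ≤ x`, is at most `E_π(x; q)`. [folklore] -/
theorem abs_sub_le_primeCountingAPErrMax {x y : ℝ} (hy1 : 1 ≤ y) (hyx : y ≤ x) {q : ℕ} (hq : 1 ≤ q)
    (a : (ZMod q)ˣ) :
    |(LevelOfDistribution.primeCountingMod q (a : ZMod q).val ⌊y⌋₊ : ℝ) -
        (Nat.primeCounting ⌊y⌋₊ : ℝ) / Nat.totient q| ≤ primeCountingAPErrMax x q := by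
  refine (abs_sub_le_primeCountingAPErr y a).trans ?_
  exact le_ciSup (f := fun y : Set.Icc (1 : ℝ) x => primeCountingAPErr y q)
    (bddAbove_range_primeCountingAPErr x hq) ⟨y, hy1, hyx⟩

/-- **The trivial bound** `E_π(x; q) ≤ 4x/φ(q)` for `1 ≤ q ≤ x` ("the crude bound
`|Δ(1_{[x+h_k,2x+h_k]} θ; a (q))| ≪ (x/q) log^{O(1)} x`", Polymath 8b p. 14, in the `π`-form).
[cite: Polymath8b2014, §4.2, p. 14] -/
theorem primeCountingAPErrMax_le {x : ℝ} {q : ℕ} (hq : 1 ≤ q) (hqx : (q : ℝ) ≤ x) :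
    primeCountingAPErrMax x q ≤ 4 * x / Nat.totient q := by
  have hx1 : (1 : ℝ) ≤ x := le_trans (by exact_mod_cast hq) hqx
  have hφpos : (0 : ℝ) < Nat.totient q := by exact_mod_cast Nat.totient_pos.2 hq
  have hφq : (Nat.totient q : ℝ) ≤ q := by exact_mod_cast Nat.totient_le q
  have hone : 1 ≤ x / Nat.totient q := by rw [le_div_iff₀ hφpos]; linarith
  refine Real.iSup_le (fun y => ?_) (by positivity)
  have hy0 : (0 : ℝ) ≤ y := le_trans zero_le_one y.2.1
  calc primeCountingAPErr y q ≤ (y : ℝ) / Nat.totient q + 2 := primeCountingAPErr_le' hy0 hq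
    _ ≤ x / Nat.totient q + 2 := by gcongr; exact y.2.2
    _ ≤ 4 * x / Nat.totient q := by
        rw [show 4 * x / (Nat.totient q : ℝ) = x / Nat.totient q + 3 * (x / Nat.totient q) by ring]
        linarith

/-! ### Divisor-weighted sums of `E_π(x; q)` below the level -/

/-- **The level-of-distribution step of §4.2** (Polymath 8b p. 14: "each choice `q` of `q_{W,d_1,…,d'_{k-1}}`
is associated to `O(τ(q)^{O(1)})` choices of `d_1,…,d'_{k-1}` … Using the crude bound … and (divisor-2)
… By the Cauchy–Schwarz inequality it suffices to show that
`∑_{q ≲ x^ϑ} sup_a |Δ(1_{[x+h_k,2x+h_k]} θ; a (q))| ≪ x log^{-A} x`"), as a statement about the `π`-form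
of the hypothesis: if `PrimesHaveLevelPi θ`, then for every `ε > 0`, `K ≥ 0` and `A > 0`,
`∑_{q ≤ x^{θ−ε}} K^{ω(q)} E_π(x; q) ≪ x/(log x)^A`.  Proof as in
`MaynardPrimesHaveLevel.isBigO_sum_pow_omega_mul`: Cauchy–Schwarz, `E_π(x;q) ≤ 4x/φ(q)`,
`∑_{q ≤ x} K^{2ω(q)}/φ(q) ≪ (log x)^{2K²}` and the hypothesis at `A' = 2A + 2K²` (`θ − ε ≤ 1` is
automatic, `not_primesHaveLevelPi_of_one_lt`).
[cite: Polymath8b2014, §4.2, p. 14] -/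
theorem PrimesHaveLevelPi.isBigO_sum_pow_omega_mul_errMax {θ ε : ℝ} (h : PrimesHaveLevelPi θ)
    (hε : 0 < ε) {K : ℝ} (hK : 0 ≤ K) {A : ℝ} (hA : 0 < A) :
    (fun x : ℝ => ∑ q ∈ Icc 1 ⌊x ^ (θ - ε)⌋₊, K ^ ω q * primeCountingAPErrMax x q) =O[atTop]
      fun x : ℝ => x / Real.log x ^ A := by
  have hθ1 : θ - ε ≤ 1 := by
    by_contra hc
    exact not_primesHaveLevelPi_of_one_lt (by linarith) h
  set c := K ^ 2 with hc
  have hc0 : 0 ≤ c := by positivity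
  have h2 := (primesHaveLevelPi_iff_errMax.1 h) (2 * A + 2 * c) (by positivity) ε hε
  obtain ⟨C, hCpos, hC⟩ := h2.exists_pos
  rw [IsBigOWith] at hC
  set B := 4 * Real.exp (2 * c * 5) * C with hB
  have hB0 : 0 ≤ B := by positivity
  refine IsBigO.of_bound (Real.sqrt B) ?_
  filter_upwards [hC, eventually_ge_atTop (3 : ℝ)] with x hCx hx3
  have hx0 : 0 < x := by linarith
  have hx1 : 1 ≤ x := by linarith
  have hlog1 : 1 ≤ Real.log x := by
    rw [Real.le_log_iff_exp_le hx0]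
    have := Real.exp_one_lt_d9
    linarith
  have hlogpos : 0 < Real.log x := by linarith
  set Q := ⌊x ^ (θ - ε)⌋₊ with hQ
  have hQx : (Q : ℝ) ≤ x := by
    calc (Q : ℝ) ≤ x ^ (θ - ε) := Nat.floor_le (by positivity)
      _ ≤ x ^ (1 : ℝ) := Real.rpow_le_rpow_of_exponent_le hx1 hθ1
      _ = x := Real.rpow_one x
  have hE0 : ∀ q, 0 ≤ primeCountingAPErrMax x q := primeCountingAPErrMax_nonneg x
  -- Cauchy–Schwarz
  have hCS : (∑ q ∈ Icc 1 Q, K ^ ω q * primeCountingAPErrMax x q) ^ 2 ≤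
      (∑ q ∈ Icc 1 Q, c ^ ω q * primeCountingAPErrMax x q) *
        ∑ q ∈ Icc 1 Q, primeCountingAPErrMax x q := by
    refine Finset.sum_sq_le_sum_mul_sum_of_sq_le_mul _
      (fun q _ => mul_nonneg (pow_nonneg hc0 _) (hE0 q)) (fun q _ => hE0 q) fun q _ => le_of_eq ?_
    rw [hc]; ring
  -- bound 1
  have hP : ∑ p ∈ Nat.primesLE Q, (1 : ℝ) / p ≤ Real.log (Real.log x) + 4 := by
    rcases le_or_gt 2 Q with hQ2 | hQ2
    · have hQpos : (0 : ℝ) < Q := by exact_mod_cast (show 0 < Q by omega)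
      have hlogQ : 0 < Real.log Q := Real.log_pos (by exact_mod_cast (show 1 < Q by omega))
      calc ∑ p ∈ Nat.primesLE Q, (1 : ℝ) / p ≤ Real.log (Real.log Q) + 4 :=
            LFunctions.MertensBound.sum_inv_prime_le Q hQ2
        _ ≤ Real.log (Real.log x) + 4 := by gcongr
    · have hempty : Nat.primesLE Q = ∅ := by
        interval_cases Q
        · exact Nat.primesLE_zero
        · exact Nat.primesLE_one
      rw [hempty, Finset.sum_empty]
      have : 0 ≤ Real.log (Real.log x) := Real.log_nonneg hlog1
      linarith
  have hB1 : ∑ q ∈ Icc 1 Q, c ^ ω q * primeCountingAPErrMax x q ≤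
      4 * x * (Real.exp (2 * c * 5) * Real.log x ^ (2 * c)) := by
    calc ∑ q ∈ Icc 1 Q, c ^ ω q * primeCountingAPErrMax x q
        ≤ ∑ q ∈ Icc 1 Q, c ^ ω q * (4 * x / Nat.totient q) := by
          refine Finset.sum_le_sum fun q hq => mul_le_mul_of_nonneg_left ?_ (by positivity)
          have hq1 : 1 ≤ q := (Finset.mem_Icc.1 hq).1
          have hqQ : q ≤ Q := (Finset.mem_Icc.1 hq).2
          exact primeCountingAPErrMax_le hq1 (le_trans (by exact_mod_cast hqQ) hQx)
      _ = 4 * x * ∑ q ∈ Icc 1 Q, c ^ ω q / (Nat.totient q : ℝ) := by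
          rw [Finset.mul_sum]
          refine Finset.sum_congr rfl fun q _ => by ring
      _ ≤ 4 * x * Real.exp (2 * c * (∑ p ∈ Nat.primesLE Q, (1 : ℝ) / p + 1)) := by
          gcongr
          exact sum_pow_omega_div_totient_le hc0 Q
      _ ≤ 4 * x * Real.exp (2 * c * (Real.log (Real.log x) + 5)) := by
          gcongr 4 * x * Real.exp (2 * c * ?_)
          linarith
      _ = 4 * x * (Real.exp (2 * c * 5) * Real.log x ^ (2 * c)) := by
          rw [show 2 * c * (Real.log (Real.log x) + 5) = 2 * c * 5 + Real.log (Real.log x) * (2 * c) by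
            ring, Real.exp_add, Real.rpow_def_of_pos hlogpos]
  -- bound 2
  have hB2 : ∑ q ∈ Icc 1 Q, primeCountingAPErrMax x q ≤ C * (x / Real.log x ^ (2 * A + 2 * c)) := by
    have hnn : 0 ≤ ∑ q ∈ Icc 1 Q, primeCountingAPErrMax x q := Finset.sum_nonneg fun q _ => hE0 q
    change ‖∑ q ∈ Icc 1 Q, primeCountingAPErrMax x q‖ ≤ C * ‖x / Real.log x ^ (2 * A + 2 * c)‖ at hCx
    rwa [Real.norm_of_nonneg hnn,
      Real.norm_of_nonneg (div_nonneg hx0.le (Real.rpow_nonneg hlogpos.le _))] at hCx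
  -- combine
  have hS0 : 0 ≤ ∑ q ∈ Icc 1 Q, K ^ ω q * primeCountingAPErrMax x q :=
    Finset.sum_nonneg fun q _ => mul_nonneg (pow_nonneg hK _) (hE0 q)
  have hxA : 0 ≤ x / Real.log x ^ A := div_nonneg hx0.le (Real.rpow_nonneg hlogpos.le _)
  have hR0 : 0 ≤ Real.sqrt B * (x / Real.log x ^ A) := mul_nonneg (Real.sqrt_nonneg _) hxA
  rw [Real.norm_of_nonneg hS0, Real.norm_of_nonneg hxA]
  rw [← pow_le_pow_iff_left₀ hS0 hR0 two_ne_zero]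
  have hL1 : Real.log x ^ (2 * A + 2 * c) = Real.log x ^ (2 * A) * Real.log x ^ (2 * c) :=
    Real.rpow_add hlogpos _ _
  have hL2 : (Real.log x ^ A) ^ 2 = Real.log x ^ (2 * A) := by
    rw [← Real.rpow_natCast, ← Real.rpow_mul hlogpos.le]
    congr 1
    push_cast
    ring
  have hLc : 0 < Real.log x ^ (2 * c) := Real.rpow_pos_of_pos hlogpos _
  have hLA : 0 < Real.log x ^ (2 * A) := Real.rpow_pos_of_pos hlogpos _
  calc (∑ q ∈ Icc 1 Q, K ^ ω q * primeCountingAPErrMax x q) ^ 2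
      ≤ (∑ q ∈ Icc 1 Q, c ^ ω q * primeCountingAPErrMax x q) * ∑ q ∈ Icc 1 Q, primeCountingAPErrMax x q := hCS
    _ ≤ (4 * x * (Real.exp (2 * c * 5) * Real.log x ^ (2 * c))) * (C * (x / Real.log x ^ (2 * A + 2 * c))) :=
        mul_le_mul hB1 hB2 (Finset.sum_nonneg fun q _ => hE0 q)
          (mul_nonneg (mul_nonneg (by norm_num) hx0.le) (mul_nonneg (Real.exp_pos _).le hLc.le))
    _ = (Real.sqrt B * (x / Real.log x ^ A)) ^ 2 := by
        rw [mul_pow, Real.sq_sqrt hB0, div_pow, hL2, hL1, hB]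
        field_simp

/-! ### `θ` in arithmetic progressions over an interval, by partial summation from `π(y; q, a)` -/

/-- `∑_{X₁ < m ≤ X₂, m ≡ r (q)} θ(m)`, the `θ`-weighted count of the primes of an interval in a residue
class (the sum `S̃` of Polymath 8b (ts), p. 13, after the change of variables `m = n + h_k`); together with
`thetaInterval` this is the `GPY.theta`-interval form of the tree's `chebyshevThetaDisc`
(`thetaAP_sub_eq_chebyshevThetaDisc`). [cite: Polymath8b2014, §4.2, (ts)] -/
def thetaAP (q r X₁ X₂ : ℕ) : ℝ :=
  ∑ m ∈ (Finset.Ioc X₁ X₂).filter (fun m => m ≡ r [MOD q]), GPY.theta m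

/-- `∑_{X₁ < m ≤ X₂} θ(m)` (the main term `∑_{x+h_k ≤ n ≤ 2x+h_k} θ(n)` of (ts); `= ϑ(X₂) − ϑ(X₁)`).
[cite: Polymath8b2014, §4.2, (ts)] -/
def thetaInterval (X₁ X₂ : ℕ) : ℝ :=
  ∑ m ∈ Finset.Ioc X₁ X₂, GPY.theta m

/-- **Bridge to the tree's discrepancies**: `thetaAP`/`thetaInterval` are the `GPY.theta`-interval
form of `chebyshevThetaDisc` (`LevelOfDistributionProofs.lean`, `ϑ(N; q, a) − ϑ(N)/φ(q)` as a sum of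
`1_{prime}(1_{≡ a} − 1/φ(q)) log n`):
`thetaAP q r X₁ X₂ − thetaInterval X₁ X₂/φ(q) = chebyshevThetaDisc q r X₂ − chebyshevThetaDisc q r X₁`.
[folklore] -/
theorem thetaAP_sub_eq_chebyshevThetaDisc (q r : ℕ) {X₁ X₂ : ℕ} (h : X₁ ≤ X₂) :
    thetaAP q r X₁ X₂ - thetaInterval X₁ X₂ / Nat.totient q =
      chebyshevThetaDisc q (r : ZMod q) X₂ - chebyshevThetaDisc q (r : ZMod q) X₁ := by
  unfold thetaAP thetaInterval chebyshevThetaDisc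
  rw [← Finset.sum_Ico_eq_sub _ (Nat.succ_le_succ h), Nat.succ_eq_add_one, Nat.succ_eq_add_one,
    Finset.Ico_add_one_add_one_eq_Ioc, Finset.sum_filter, Finset.sum_div, ← Finset.sum_sub_distrib]
  refine Finset.sum_congr rfl fun m _ => ?_
  unfold GPY.theta apIndicator
  have hiff : ((m : ZMod q) = (r : ZMod q)) ↔ m ≡ r [MOD q] := ZMod.natCast_eq_natCast_iff _ _ _
  by_cases hp : m.Prime
  · by_cases hr : m ≡ r [MOD q]
    · simp only [hp, hr, hiff.2 hr, if_true]; ring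
    · have hr' : ¬ ((m : ZMod q) = (r : ZMod q)) := fun h => hr (hiff.1 h)
      simp only [hp, hr, hr', if_true, if_false]; ring
  · by_cases hr : m ≡ r [MOD q]
    · simp only [hp, hr, if_false, if_true]; ring
    · simp only [hp, hr, if_false]; ring

/-- `|π(n; q, r) − π(n)/φ(q)| ≤ E_π(X; q)` for all `n ≤ X`, `(r, q) = 1` (`primeCountingDisc` form). [folklore] -/
theorem abs_primeCountingDisc_le_errMax {q r X : ℕ} (hq : 1 ≤ q) (hr : r.Coprime q) {n : ℕ}
    (hn : n ≤ X) : |primeCountingDisc q (r : ZMod q) n| ≤ primeCountingAPErrMax X q := by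
  haveI : NeZero q := ⟨by omega⟩
  rcases Nat.eq_zero_or_pos n with rfl | hnpos
  · have h0 : primeCountingDisc q (r : ZMod q) 0 = 0 := by simp [primeCountingDisc, Nat.not_prime_zero]
    rw [h0, abs_zero]
    exact primeCountingAPErrMax_nonneg _ _
  · set a : (ZMod q)ˣ := ZMod.unitOfCoprime r hr with ha
    have hav : ((a : ZMod q)) = (r : ZMod q) := by rw [ha, ZMod.coe_unitOfCoprime]
    rw [← hav, ← primeCountingMod_sub_div_eq (NeZero.ne q) (a : ZMod q) n]
    have h := abs_sub_le_primeCountingAPErrMax (x := (X : ℝ)) (y := (n : ℝ)) (by exact_mod_cast hnpos)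
      (by exact_mod_cast hn) hq a
    rwa [Nat.floor_natCast] at h

/-- **`θ` in a progression against its mean, by partial summation** ("it is not difficult to show that
`|Δ(1_{[x+h_k,2x+h_k]} θ; a (q)) − Δ(1_{[x+h_k,2x+h_k]} Λ; a (q))| ≲ √(x/q)`", Polymath 8b p. 14 — here
the comparison is made directly with `π(y; q, a)`, which avoids the prime powers altogether): for
`(r, q) = 1` and `X₁ ≤ X₂`,
`|∑_{X₁<m≤X₂, m≡r(q)} θ(m) − (1/φ(q)) ∑_{X₁<m≤X₂} θ(m)| ≤ 4 log X₂ · E_π(X₂; q)`, from the bridge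
`thetaAP_sub_eq_chebyshevThetaDisc` and the tree's `π → ϑ` partial summation
`abs_chebyshevThetaDisc_le_of_primeCountingDisc` (bound `2 M log N`) at `N = X₂` and `N = X₁`.
[cite: Polymath8b2014, §4.2, p. 14] -/
theorem abs_thetaAP_sub_le {q r X₁ X₂ : ℕ} (hq : 1 ≤ q) (hr : r.Coprime q) (hX : X₁ ≤ X₂) :
    |thetaAP q r X₁ X₂ - thetaInterval X₁ X₂ / Nat.totient q| ≤
      4 * Real.log X₂ * primeCountingAPErrMax X₂ q := by
  set E : ℝ := primeCountingAPErrMax X₂ q with hE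
  have hE0 : 0 ≤ E := primeCountingAPErrMax_nonneg _ _
  have hdisc : ∀ n ≤ X₂, |primeCountingDisc q (r : ZMod q) n| ≤ E := fun n hn =>
    abs_primeCountingDisc_le_errMax hq hr hn
  have h2 := abs_chebyshevThetaDisc_le_of_primeCountingDisc (N := X₂) hdisc
  have h1 := abs_chebyshevThetaDisc_le_of_primeCountingDisc (N := X₁) fun n hn => hdisc n (hn.trans hX)
  have hlog0 : 0 ≤ Real.log X₂ := Real.log_natCast_nonneg _
  have hlog : Real.log X₁ ≤ Real.log X₂ := by
    rcases Nat.eq_zero_or_pos X₁ with h0 | hpos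
    · rw [h0, Nat.cast_zero, Real.log_zero]; exact hlog0
    · exact Real.log_le_log (by exact_mod_cast hpos) (by exact_mod_cast hX)
  rw [thetaAP_sub_eq_chebyshevThetaDisc q r hX]
  calc |chebyshevThetaDisc q (r : ZMod q) X₂ - chebyshevThetaDisc q (r : ZMod q) X₁|
      ≤ |chebyshevThetaDisc q (r : ZMod q) X₂| + |chebyshevThetaDisc q (r : ZMod q) X₁| := abs_sub _ _
    _ ≤ 2 * E * Real.log X₂ + 2 * E * Real.log X₁ := add_le_add h2 h1
    _ ≤ 2 * E * Real.log X₂ + 2 * E * Real.log X₂ := by gcongr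
    _ = 4 * Real.log X₂ * E := by ring

end Literature.NumberTheory.Sieve
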